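import Mathlib.Data.Matrix.Mul
import Mathlib.LinearAlgebra.Matrix.DotProduct
import Mathlib.LinearAlgebra.Matrix.NonsingularInverse
import Mathlib.LinearAlgebra.Matrix.Notation
import Mathlib.Analysis.SpecialFunctions.Trigonometric.Basic
import Mathlib.Tactic.Linarith
import Mathlib.Tactic.Ring
import Mathlib.Tactic.FinCases
import HarnessLib

/-!
# Point-pattern matching by a similarity transformation: the convex quadratic and its closed-form
# minimiser (Antoniou–Lu, §9.2)

[AL07] = A. Antoniou, W.-S. Lu, *Practical Optimization* [AntoniouLu2007], §9.2 "Point-Pattern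
Matching", pp. 232–236 (held copy `book:antoniou2007-practical-optimization`, read).

Two planar point patterns are *similar* when `p̃_i = η R(θ) p_i + r` for a rotation angle `θ`, a
scaling `η` and a translation `r` ((9.2)); the substitution `a = η cos θ`, `b = η sin θ` makes the
transformation `p̃_i = [[a, −b], [b, a]] p_i + r` LINEAR in the parameter vector `x = (a, b, r₁,
r₂)`
((9.3)): `p̃_i = [R_i I₂] x` with `R_i = [[p_{i1}, −p_{i2}], [p_{i2}, p_{i1}]]`.  The matching
problem
`minimise ‖P̃(x) − Q‖_F² = Σ_i ‖p̃_i(x) − q_i‖²` ((9.4)) is therefore the quadratic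
`xᵀHx − 2xᵀb + κ` with `H = Σ_i [R_i I₂]ᵀ[R_i I₂]` (blocks `Σ R_iᵀR_i`, `Σ R_iᵀ`, `Σ R_i`, `nI₂`),
`b = Σ_i [R_i I₂]ᵀq_i`, `κ = Σ_i ‖q_i‖²` ((9.6a)–(9.6d)); its gradient is `2Hx − 2b` and, `H` being
positive definite (Prob. 9.1(b)), the unique minimiser is `x* = H⁻¹b` ((9.7)).

Rendering (points as `Fin 2 → ℝ`, squared Euclidean length as `v ⬝ᵥ v`): `rotScale`, `designMat`
(`[R_i I₂]`), `simTransform` with `simTransform_apply` ((9.3)) and `simTransform_polar` ((9.2) ⇒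
(9.3)); `rotScale_transpose_mul_self` (`R_iᵀR_i = ‖p_i‖²I₂`, the structure of (9.6b)); the
objective `matchError` ((9.4)) and its quadratic form `matchError_eq_quadratic` ((9.6a) with
(9.6b)–(9.6d) as `hessH`, `linB`, `kappa`); `hessH_quadForm_nonneg` (`vᵀHv = Σ‖[R_i I₂]v‖² ≥ 0`);
`matchError_expand_at_solution` and `isMin_of_normal_eq` (a solution of `Hx = b` minimises (9.4));
`xstar_solves` ((9.7): `x* = H⁻¹b` solves `Hx = b` when `H` is invertible).  Positive definiteness
of `H` for a non-degenerate pattern (Prob. 9.1(b)) is not derived here; invertibility enters (9.7)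
as
a hypothesis.

Published results only (Lean placement rule): every public declaration carries its
`[cite: AntoniouLu2007, §9.2 …]` locator.
-/

namespace Literature.Analysis.Convex.PointPatternMatching

open Matrix Finset

/-- `R_i = [[p₁, −p₂], [p₂, p₁]]` — the rotation–scaling block of the point `p`.
[cite: AntoniouLu2007, §9.2 (9.6b)] -/
def rotScale (p : Fin 2 → ℝ) : Matrix (Fin 2) (Fin 2) ℝ := !![p 0, -(p 1); p 1, p 0]

/-- The design matrix `[R_i I₂] = [[p₁, −p₂, 1, 0], [p₂, p₁, 0, 1]]` of the point `p`.
[cite: AntoniouLu2007, §9.2 (display before (9.6a))] -/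
def designMat (p : Fin 2 → ℝ) : Matrix (Fin 2) (Fin 4) ℝ := !![p 0, -(p 1), 1, 0; p 1, p 0, 0, 1]

/-- The similarity transformation in the linear parameters `x = (a, b, r₁, r₂)`: `p̃ = [R I₂]x`.
[cite: AntoniouLu2007, §9.2 (9.3)] -/
def simTransform (x : Fin 4 → ℝ) (p : Fin 2 → ℝ) : Fin 2 → ℝ := designMat p *ᵥ x

/-- **(9.3).** `p̃ = (a p₁ − b p₂ + r₁, b p₁ + a p₂ + r₂)`. [cite: AntoniouLu2007, §9.2 (9.3)] -/
theorem simTransform_apply (x : Fin 4 → ℝ) (p : Fin 2 → ℝ) :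
    simTransform x p = ![x 0 * p 0 - x 1 * p 1 + x 2, x 1 * p 0 + x 0 * p 1 + x 3] := by
  ext i
  fin_cases i <;> simp [simTransform, designMat, mulVec, dotProduct, Fin.sum_univ_four] <;> ring

/-- **(9.2) ⇒ (9.3).** With `a = η cos θ`, `b = η sin θ` the transformation is the scaled rotation
plus translation `η R(θ) p + r`. [cite: AntoniouLu2007, §9.2 (9.2)–(9.3)] -/
theorem simTransform_polar (η θ r₁ r₂ : ℝ) (p : Fin 2 → ℝ) :
    simTransform ![η * Real.cos θ, η * Real.sin θ, r₁, r₂] p =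
      η • (!![Real.cos θ, -Real.sin θ; Real.sin θ, Real.cos θ] *ᵥ p) + ![r₁, r₂] := by
  rw [simTransform_apply]
  ext i
  fin_cases i <;> simp [dotProduct, Fin.sum_univ_two] <;> ring

/-- `R_iᵀR_i = ‖p_i‖² I₂` (so `Σ_i R_iᵀR_i = (Σ_i‖p_i‖²) I₂` in (9.6b)).
[cite: AntoniouLu2007, §9.2 (9.6b)] -/
theorem rotScale_transpose_mul_self (p : Fin 2 → ℝ) :
    (rotScale p)ᵀ * rotScale p = (p ⬝ᵥ p) • (1 : Matrix (Fin 2) (Fin 2) ℝ) := by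
  ext i j
  fin_cases i <;> fin_cases j <;>
    simp [rotScale, Matrix.mul_apply, dotProduct, Fin.sum_univ_two] <;> ring

variable {n : ℕ}

/-- **(9.4).** The matching error `Σ_i ‖p̃_i(x) − q_i‖²` (squared Frobenius distance `‖P̃(x) −
Q‖_F²`).
[cite: AntoniouLu2007, §9.2 (9.4)–(9.5)] -/
def matchError (P Q : Fin n → Fin 2 → ℝ) (x : Fin 4 → ℝ) : ℝ :=
  ∑ i, (simTransform x (P i) - Q i) ⬝ᵥ (simTransform x (P i) - Q i)

/-- **(9.6b).** `H = Σ_i [R_i I₂]ᵀ[R_i I₂]`. [cite: AntoniouLu2007, §9.2 (9.6b)] -/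
def hessH (P : Fin n → Fin 2 → ℝ) : Matrix (Fin 4) (Fin 4) ℝ := ∑ i, (designMat
    (P i))ᵀ * designMat (P i)

/-- **(9.6c).** `b = Σ_i [R_i I₂]ᵀ q_i`. [cite: AntoniouLu2007, §9.2 (9.6c)] -/
def linB (P Q : Fin n → Fin 2 → ℝ) : Fin 4 → ℝ := ∑ i, (designMat (P i))ᵀ *ᵥ Q i

/-- **(9.6d).** `κ = Σ_i ‖q_i‖²`. [cite: AntoniouLu2007, §9.2 (9.6d)] -/
def kappa (Q : Fin n → Fin 2 → ℝ) : ℝ := ∑ i, Q i ⬝ᵥ Q i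

/-- **(9.6a).** `‖P̃(x) − Q‖_F² = xᵀHx − 2xᵀb + κ`. [cite: AntoniouLu2007, §9.2 (9.6a)–(9.6d);
Prob. 9.1(a)] -/
theorem matchError_eq_quadratic (P Q : Fin n → Fin 2 → ℝ) (x : Fin 4 → ℝ) :
    matchError P Q x = x ⬝ᵥ hessH P *ᵥ x - 2 * (x ⬝ᵥ linB P Q) + kappa Q := by
  unfold matchError hessH linB kappa simTransform
  rw [Matrix.sum_mulVec, dotProduct_sum, dotProduct_sum, Finset.mul_sum, ← Finset.sum_sub_distrib,
    ← Finset.sum_add_distrib]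
  refine Finset.sum_congr rfl fun i _ => ?_
  have h1 : x ⬝ᵥ ((designMat (P i))ᵀ * designMat (P i)) *ᵥ x =
      (designMat (P i) *ᵥ x) ⬝ᵥ (designMat (P i) *ᵥ x) := by
    rw [← mulVec_mulVec, dotProduct_mulVec, vecMul_transpose]
  have h2 : x ⬝ᵥ (designMat (P i))ᵀ *ᵥ Q i = (designMat (P i) *ᵥ x) ⬝ᵥ Q i := by
    rw [dotProduct_mulVec, vecMul_transpose]
  rw [h1, h2]
  simp only [sub_dotProduct, dotProduct_sub, dotProduct_comm (Q i) (designMat (P i) *ᵥ x)]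
  ring

/-- `H` is positive semidefinite as a quadratic form: `vᵀHv = Σ_i ‖[R_i I₂]v‖² ≥ 0` (the book notes
`H ≻ 0` for a genuine pattern, Prob. 9.1(b)). [cite: AntoniouLu2007, §9.2 (9.6b); Prob. 9.1(b)] -/
theorem hessH_quadForm_nonneg (P : Fin n → Fin 2 → ℝ) (v : Fin 4 → ℝ) : 0 ≤ v ⬝ᵥ hessH P *ᵥ v := by
  unfold hessH
  rw [Matrix.sum_mulVec, dotProduct_sum]
  refine Finset.sum_nonneg fun i _ => ?_
  rw [← mulVec_mulVec, dotProduct_mulVec, vecMul_transpose]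
  exact Finset.sum_nonneg fun j _ => mul_self_nonneg _

/-- Expansion about a solution of the normal equations: if `Hx* = b` then
`‖P̃(x) − Q‖_F² = ‖P̃(x*) − Q‖_F² + (x − x*)ᵀH(x − x*)` (gradient `2Hx − 2b` vanishes at `x*`).
[cite: AntoniouLu2007, §9.2 (9.6a), gradient `g(x) = 2Hx − 2b`] -/
theorem matchError_expand_at_solution (P Q : Fin n → Fin 2 → ℝ) {xs : Fin 4 → ℝ}
    (hxs : hessH P *ᵥ xs = linB P Q) (x : Fin 4 → ℝ) :
    matchError P Q x = matchError P Q xs + (x - xs) ⬝ᵥ hessH P *ᵥ (x - xs) := by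
  have hsymm : (hessH P)ᵀ = hessH P := by
    unfold hessH
    rw [transpose_sum]
    refine Finset.sum_congr rfl fun i _ => ?_
    rw [transpose_mul, transpose_transpose]
  have hcomm : xs ⬝ᵥ hessH P *ᵥ x = x ⬝ᵥ hessH P *ᵥ xs := by
    rw [dotProduct_mulVec, ← mulVec_transpose, hsymm, dotProduct_comm]
  rw [matchError_eq_quadratic, matchError_eq_quadratic, ← hxs]
  simp only [mulVec_sub, sub_dotProduct, dotProduct_sub, hcomm]
  ring

/-- **A solution of `Hx = b` minimises (9.4)** ("the unique global minimizer can be obtained … by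
letting g(x) = 2Hx − 2b = 0"). [cite: AntoniouLu2007, §9.2 (9.7) and the preceding display] -/
theorem isMin_of_normal_eq (P Q : Fin n → Fin 2 → ℝ) {xs : Fin 4 → ℝ}
    (hxs : hessH P *ᵥ xs = linB P Q) (x : Fin 4 → ℝ) : matchError P Q xs ≤ matchError P Q x := by
  rw [matchError_expand_at_solution P Q hxs x]
  exact le_add_of_nonneg_right (hessH_quadForm_nonneg P (x - xs))

/-- **(9.7).** When `H` is invertible, `x* = H⁻¹b` solves `Hx = b` and hence is the minimiser.
[cite: AntoniouLu2007, §9.2 (9.7)] -/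
theorem xstar_solves (P Q : Fin n → Fin 2 → ℝ) (h : IsUnit (hessH P).det) :
    hessH P *ᵥ ((hessH P)⁻¹ *ᵥ linB P Q) = linB P Q := by
  rw [mulVec_mulVec, mul_nonsing_inv _ h, one_mulVec]

/-- **(9.7), minimality.** `‖P̃(H⁻¹b) − Q‖_F² ≤ ‖P̃(x) − Q‖_F²` for all `x` (invertible `H`).
[cite: AntoniouLu2007, §9.2 (9.7)] -/
theorem xstar_isMin (P Q : Fin n → Fin 2 → ℝ) (h : IsUnit (hessH P).det) (x : Fin 4 → ℝ) :
    matchError P Q ((hessH P)⁻¹ *ᵥ linB P Q) ≤ matchError P Q x :=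
  isMin_of_normal_eq P Q (xstar_solves P Q h) x

end Literature.Analysis.Convex.PointPatternMatching
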